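import Literature.NumberTheory.Transcendental.RoySmallValueDistance
import HarnessLib

/-!
# Roy's small value estimate for `𝔾ₐ × 𝔾ₘ` — §4: the test polynomials of Proposition 4.5

Topic `Literature/NumberTheory/Transcendental`. Part of the formalisation of the proof of Roy 2013,
Theorem 1.1 (named fact `roy2013_thm_1_1`, `RoySmallValueEstimates.lean`). Source: D. Roy,
*A small value estimate for `𝔾ₐ × 𝔾ₘ`*, Mathematika 59 (2013) 333–363 = arXiv:1301.0663, §4,
proof of Proposition 4.5 (p. 12 of the arXiv text).

The proof of Proposition 4.5 evaluates at `α` two explicit elements of `I_T^{(γ,T)}`: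

* "a linear form `M ∈ ℂ[X]_1` with `M(1, γ) = 0`, `‖M‖ ≤ 1` and `dist(α,(1:γ)) = |M(α)|`": by
  (4.1), one of `X₁ - ξX₀`, `X₂ - ηX₀`, `ηX₁ - ξX₂` (`linForm ξ η j`) up to the factor `c₂`
  (`exists_linForm_ge`); then `M^T ∈ I_T^{(γ,T)}` (`pow_mul_mem_vanIdeal`, a Leibniz induction);
* `Q = X₀^{T-1}X₂ - η ∑_{i<T} (X₁ - ξX₀)ⁱ X₀^{T-i}/i!` (`royQ ξ η T`), which "also belongs to
  `I_T^{(γ,T)}`" (`royQ_mem_vanIdeal`: `𝒟` shifts the terms of the sum, `𝒟uᵢ = u_{i-1}`), has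
  `𝓛(Q) ≤ 1 + |η|e^{1+|ξ|}` (`l1Norm_royQ_le`) and satisfies
  `Q(α) = α₀^T (α₂/α₀ - η ∑_{i<T} δ₁ⁱ/i!)`, `δ₁ = α₁/α₀ - ξ` (`aeval_royQ`).

Also the elementary "weighted pigeonhole" used to pass from a decomposition
`∑ X^ν P_ν` (Proposition 3.7) to one good `P_ν` (`exists_weighted_pigeonhole`).

Definitions: `linForm`, `royQ`. Everything is proved; no new named facts.

## References

* [Roy2013] D. Roy, *A small value estimate for 𝔾ₐ × 𝔾ₘ*, Mathematika 59 (2013), 333–363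
  (arXiv:1301.0663), §4, proof of Proposition 4.5.
-/

noncomputable section

open MvPolynomial Finset Complex

namespace Literature.NumberTheory.Transcendental

namespace Roy2013

open Nesterenko

/-! ### Weighted pigeonhole -/

/-- If `R ≤ ∑ fᵢ`, `gᵢ ≥ 0`, `fᵢ = 0` whenever `gᵢ = 0`, and `∑ gᵢ > 0`, then some `i` with
`gᵢ > 0` has `gᵢ R ≤ fᵢ ∑ⱼ gⱼ`. [folklore] -/
theorem exists_weighted_pigeonhole {ι : Type*} (s : Finset ι) (f g : ι → ℝ) {R : ℝ}
    (hg : ∀ i ∈ s, 0 ≤ g i) (hfg : ∀ i ∈ s, g i = 0 → f i = 0)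
    (hS : 0 < ∑ i ∈ s, g i) (hR : R ≤ ∑ i ∈ s, f i) :
    ∃ i ∈ s, 0 < g i ∧ g i * R ≤ f i * ∑ j ∈ s, g j := by
  by_contra h
  push Not at h
  -- every `i` satisfies `f i * S ≤ g i * R`, strictly if `g i > 0`
  have hle : ∀ i ∈ s, f i * ∑ j ∈ s, g j ≤ g i * R := by
    intro i hi
    rcases (hg i hi).lt_or_eq with hpos | hzero
    · exact (h i hi hpos).le
    · rw [hfg i hi hzero.symm, ← hzero, zero_mul, zero_mul]
  obtain ⟨i₀, hi₀, hgi₀⟩ : ∃ i ∈ s, 0 < g i := by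
    by_contra h'
    push Not at h'
    exact absurd (Finset.sum_nonpos h') (not_le.mpr hS)
  have hlt : ∑ i ∈ s, f i * ∑ j ∈ s, g j < ∑ i ∈ s, g i * R :=
    Finset.sum_lt_sum hle ⟨i₀, hi₀, h i₀ hi₀ hgi₀⟩
  rw [← Finset.sum_mul, ← Finset.sum_mul] at hlt
  have : R * ∑ j ∈ s, g j ≤ (∑ i ∈ s, f i) * ∑ j ∈ s, g j :=
    mul_le_mul_of_nonneg_right hR hS.le
  linarith

/-! ### The three linear forms vanishing at `(1:γ)` -/

/-- The linear forms `X₁ - ξX₀`, `X₂ - ηX₀`, `ηX₁ - ξX₂`, whose values at `α` are the three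
`2 × 2` minors in Roy's formula (4.1) for `dist(α,(1:γ))`. [cite: Roy2013, §4, (4.1)] -/
def linForm (ξ η : ℂ) : Fin 3 → CX :=
  ![X 1 - C ξ * X 0, X 2 - C η * X 0, C η * X 1 - C ξ * X 2]

/-- Each `linForm` is a linear form. [cite: Roy2013, §4, (4.1)] -/
theorem isHomogeneous_linForm (ξ η : ℂ) (j : Fin 3) : (linForm ξ η j).IsHomogeneous 1 := by
  fin_cases j
  · exact (homogeneousSubmodule (Fin 3) ℂ 1).sub_mem (isHomogeneous_X ℂ 1)
      ((isHomogeneous_X ℂ 0).C_mul ξ)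
  · exact (homogeneousSubmodule (Fin 3) ℂ 1).sub_mem (isHomogeneous_X ℂ 2)
      ((isHomogeneous_X ℂ 0).C_mul η)
  · exact (homogeneousSubmodule (Fin 3) ℂ 1).sub_mem ((isHomogeneous_X ℂ 1).C_mul η)
      ((isHomogeneous_X ℂ 2).C_mul ξ)

/-- Each `linForm` vanishes at `(1, ξ, η)`. [cite: Roy2013, §4, proof of Proposition 4.5] -/
theorem aeval_one_linForm (ξ η : ℂ) (j : Fin 3) : aeval ![1, ξ, η] (linForm ξ η j) = 0 := by
  fin_cases j
  · simp [linForm]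
  · simp [linForm]
  · simp [linForm]; ring

/-- Values of the `linForm`s at `α`. [cite: Roy2013, §4, (4.1)] -/
theorem aeval_linForm (ξ η : ℂ) (α : Fin 3 → ℂ) :
    aeval α (linForm ξ η 0) = α 1 - α 0 * ξ ∧ aeval α (linForm ξ η 1) = α 2 - α 0 * η ∧
      aeval α (linForm ξ η 2) = α 1 * η - α 2 * ξ := by
  refine ⟨?_, ?_, ?_⟩ <;> simp [linForm] <;> ring

/-- `𝓛(linForm) ≤ 2c₂` (Roy: `𝓛(M) ≤ 3` for his normalised `M`). [cite: Roy2013, §4, proof of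
Proposition 4.5] -/
theorem l1Norm_linForm_le (ξ η : ℂ) (j : Fin 3) : l1Norm (linForm ξ η j) ≤ 2 * roy_c2 ξ η := by
  have hξ := norm_le_roy_c2_left ξ η
  have hη := norm_le_roy_c2_right ξ η
  have h1 := one_le_roy_c2 ξ η
  have hCX : ∀ (c : ℂ) (i : Fin 3), l1Norm (C c * X i : CX) ≤ ‖c‖ := fun c i =>
    (l1Norm_C_mul_le _ _).trans (by rw [l1Norm_X, mul_one])
  fin_cases j
  · change l1Norm (X 1 - C ξ * X 0 : CX) ≤ _
    refine (l1Norm_sub_le _ _).trans ?_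
    rw [l1Norm_X]; linarith [hCX ξ 0]
  · change l1Norm (X 2 - C η * X 0 : CX) ≤ _
    refine (l1Norm_sub_le _ _).trans ?_
    rw [l1Norm_X]; linarith [hCX η 0]
  · change l1Norm (C η * X 1 - C ξ * X 2 : CX) ≤ _
    refine (l1Norm_sub_le _ _).trans ?_
    linarith [hCX η 1, hCX ξ 2]

/-- **(4.1) realised by a linear form**: some `linForm ξ η j` has
`|linForm(α)| ≥ c₂ dist(α,(1:γ))` (in fact `=`). [cite: Roy2013, §4, proof of Proposition 4.5] -/
theorem exists_linForm_ge (ξ η : ℂ) (α : Fin 3 → ℂ) :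
    ∃ j : Fin 3, roy_c2 ξ η * pdist ξ η α ≤ ‖aeval α (linForm ξ η j)‖ := by
  obtain ⟨h0, h1, h2⟩ := aeval_linForm ξ η α
  have hc : roy_c2 ξ η * pdist ξ η α =
      max (max ‖α 1 - α 0 * ξ‖ ‖α 2 - α 0 * η‖) ‖α 1 * η - α 2 * ξ‖ := by
    rw [pdist, mul_div_cancel₀ _ (ne_of_gt (lt_of_lt_of_le one_pos (one_le_roy_c2 ξ η)))]
  rw [hc]
  rcases le_total (max ‖α 1 - α 0 * ξ‖ ‖α 2 - α 0 * η‖) ‖α 1 * η - α 2 * ξ‖ with h | h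
  · exact ⟨2, by rw [max_eq_right h, h2]⟩
  · rw [max_eq_left h]
    rcases le_total ‖α 1 - α 0 * ξ‖ ‖α 2 - α 0 * η‖ with h' | h'
    · exact ⟨1, by rw [max_eq_right h', h1]⟩
    · exact ⟨0, by rw [max_eq_left h', h0]⟩

/-! ### Powers of a polynomial vanishing at `(1:γ)` -/

/-- **Leibniz induction for powers**: if `M(1, γ) = 0` then `𝒟ⁱ(M^T F)(1, γ) = 0` for all
`i < T` and all `F`. [cite: Roy2013, §4, proof of Proposition 4.5] -/
theorem aeval_iterate_homD_pow_mul_eq_zero {ξ η : ℂ} {M : CX} (hM : aeval ![1, ξ, η] M = 0) :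
    ∀ (i T : ℕ) (F : CX), i < T → aeval ![1, ξ, η] (homD^[i] (M ^ T * F)) = 0 := by
  intro i
  induction i with
  | zero =>
    intro T F hT
    obtain ⟨T', rfl⟩ := Nat.exists_eq_add_of_le' hT
    rw [Function.iterate_zero_apply, pow_succ, map_mul, map_mul, hM, mul_zero, zero_mul]
  | succ i ih =>
    intro T F hT
    obtain ⟨T', rfl⟩ := Nat.exists_eq_add_of_le' (Nat.one_le_of_lt hT)
    have hcomm : F * ((T' + 1) • (M ^ (T' + 1 - 1) * homD M)) =
        M ^ T' * ((T' + 1 : ℕ) • (F * homD M)) := by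
      rw [Nat.add_sub_cancel, nsmul_eq_mul, nsmul_eq_mul]; ring
    rw [Function.iterate_succ_apply, Derivation.leibniz, Derivation.leibniz_pow, smul_eq_mul,
      smul_eq_mul, smul_eq_mul, hcomm, iterate_homD_add, map_add,
      ih (T' + 1) (homD F) (by omega), ih T' _ (by omega), add_zero]

/-- If `M(1, γ) = 0` then `M^T F ∈ vanIdeal ξ η T` for every `F`; in particular
`M^T ∈ I_T^{(γ,T)}` for a linear form `M` vanishing at `(1:γ)`.
[cite: Roy2013, §4, proof of Proposition 4.5] -/
theorem pow_mul_mem_vanIdeal {ξ η : ℂ} {M : CX} (hM : aeval ![1, ξ, η] M = 0) (T : ℕ) (F : CX) :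
    M ^ T * F ∈ vanIdeal ξ η T := fun i hi => aeval_iterate_homD_pow_mul_eq_zero hM i T F hi

/-! ### The polynomial `Q` of the proof of Proposition 4.5 -/

/-- Roy's `Q(X) = X₀^{T-1}X₂ - η ∑_{i=0}^{T-1} (1/i!) (X₁ - ξX₀)ⁱ X₀^{T-i} ∈ I_T^{(γ,T)}`.
[cite: Roy2013, §4, proof of Proposition 4.5] -/
def royQ (ξ η : ℂ) (T : ℕ) : CX :=
  X 0 ^ (T - 1) * X 2 -
    C η * ∑ i ∈ range T, C ((i.factorial : ℂ)⁻¹) * (X 1 - C ξ * X 0) ^ i * X 0 ^ (T - i)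

/-- `𝒟(X₁ - ξX₀) = X₀`. [cite: Roy2013, §4, proof of Proposition 4.5] -/
theorem homD_linForm_zero (ξ : ℂ) : homD (X 1 - C ξ * X 0 : CX) = X 0 := by
  rw [map_sub, homD_X_one, homD_C_mul, homD_X_zero, mul_zero, sub_zero]

/-- The terms `uᵢ = (1/i!) (X₁ - ξX₀)ⁱ X₀^{T-i}` are shifted by `𝒟`: `𝒟u₀ = 0`.
[cite: Roy2013, §4, proof of Proposition 4.5] -/
theorem homD_royQ_term_zero (ξ : ℂ) (T : ℕ) :
    homD (C (((0 : ℕ).factorial : ℂ)⁻¹) * (X 1 - C ξ * X 0) ^ 0 * X 0 ^ (T - 0) : CX) = 0 := by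
  simp only [Derivation.leibniz, Derivation.leibniz_pow, homD_X_zero, homD_C, pow_zero,
    smul_zero, add_zero, Derivation.map_one_eq_zero]

/-- The terms `uᵢ` are shifted by `𝒟`: `𝒟u_{j+1} = u_j` for `j + 1 ≤ T`.
[cite: Roy2013, §4, proof of Proposition 4.5] -/
theorem homD_royQ_term_succ (ξ : ℂ) {T j : ℕ} (hj : j + 1 ≤ T) :
    homD (C (((j + 1).factorial : ℂ)⁻¹) * (X 1 - C ξ * X 0) ^ (j + 1) * X 0 ^ (T - (j + 1)) : CX) =
      C ((j.factorial : ℂ)⁻¹) * (X 1 - C ξ * X 0) ^ j * X 0 ^ (T - j) := by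
  have hfac : ((j + 1 : ℕ) : CX) * C (((j + 1).factorial : ℂ)⁻¹) = C ((j.factorial : ℂ)⁻¹) := by
    rw [Nat.factorial_succ, Nat.cast_mul, mul_inv, C_mul, ← mul_assoc, ← map_natCast C (j + 1),
      ← C_mul, mul_inv_cancel₀ (Nat.cast_ne_zero.mpr (Nat.succ_ne_zero j)), C_1, one_mul]
  have hpow : (X 0 : CX) ^ (T - (j + 1)) * X 0 = X 0 ^ (T - j) := by
    rw [← pow_succ]; congr 1; omega
  simp only [Derivation.leibniz, Derivation.leibniz_pow, homD_linForm_zero, homD_X_zero, homD_C,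
    smul_eq_mul, nsmul_eq_mul, smul_zero, mul_zero, add_zero, zero_add, Nat.add_sub_cancel]
  linear_combination ((X 1 - C ξ * X 0) ^ j * X 0 ^ (T - (j + 1)) * X 0) * hfac +
    (C ((j.factorial : ℂ)⁻¹) * (X 1 - C ξ * X 0) ^ j) * hpow

/-- `𝒟 (∑_{i<n} uᵢ) = ∑_{i<n-1} uᵢ` for `n ≤ T`. [cite: Roy2013, §4, proof of Proposition 4.5] -/
theorem homD_sum_royQ_terms (ξ : ℂ) (T : ℕ) :
    ∀ n ≤ T, homD (∑ i ∈ range n, C ((i.factorial : ℂ)⁻¹) * (X 1 - C ξ * X 0) ^ i *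
      X 0 ^ (T - i) : CX) =
      ∑ i ∈ range (n - 1), C ((i.factorial : ℂ)⁻¹) * (X 1 - C ξ * X 0) ^ i * X 0 ^ (T - i) := by
  intro n hn
  induction n with
  | zero => simp
  | succ n ih =>
    rw [Finset.sum_range_succ, map_add, ih (by omega), Nat.add_sub_cancel]
    rcases Nat.eq_zero_or_pos n with rfl | hn0
    · rw [homD_royQ_term_zero]; simp
    · obtain ⟨m, rfl⟩ : ∃ m, n = m + 1 := ⟨n - 1, by omega⟩
      rw [homD_royQ_term_succ ξ (T := T) (j := m) (by omega), Nat.add_sub_cancel,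
        Finset.sum_range_succ]

/-- `𝒟ʲ (∑_{i<T} uᵢ) = ∑_{i<T-j} uᵢ`. [cite: Roy2013, §4, proof of Proposition 4.5] -/
theorem iterate_homD_sum_royQ_terms (ξ : ℂ) (T j : ℕ) :
    homD^[j] (∑ i ∈ range T, C ((i.factorial : ℂ)⁻¹) * (X 1 - C ξ * X 0) ^ i *
      X 0 ^ (T - i) : CX) =
      ∑ i ∈ range (T - j), C ((i.factorial : ℂ)⁻¹) * (X 1 - C ξ * X 0) ^ i * X 0 ^ (T - i) := by
  induction j with
  | zero => simp
  | succ j ih =>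
    rw [Function.iterate_succ_apply', ih, homD_sum_royQ_terms ξ T (T - j) (Nat.sub_le _ _)]
    rfl

/-- The terms `uᵢ` at `(1, γ)`: `u₀(1,γ) = 1`, `uᵢ(1,γ) = 0` for `i ≥ 1`; hence
`(∑_{i<n} uᵢ)(1, γ) = 1` for `n ≥ 1`. [cite: Roy2013, §4, proof of Proposition 4.5] -/
theorem aeval_one_sum_royQ_terms (ξ η : ℂ) (T : ℕ) {n : ℕ} (hn : 1 ≤ n) :
    aeval ![1, ξ, η] (∑ i ∈ range n, C ((i.factorial : ℂ)⁻¹) * (X 1 - C ξ * X 0) ^ i *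
      X 0 ^ (T - i) : CX) = 1 := by
  rw [map_sum, Finset.sum_eq_single_of_mem 0 (mem_range.mpr hn)]
  · simp
  · intro i _ hi
    simp [zero_pow hi]

/-- **`Q ∈ I^{(γ,T)}`**: `𝒟ʲQ(1, γ) = η - η = 0` for `j < T`.
[cite: Roy2013, §4, proof of Proposition 4.5] -/
theorem royQ_mem_vanIdeal (ξ η : ℂ) (T : ℕ) : royQ ξ η T ∈ vanIdeal ξ η T := by
  intro j hj
  have h1 : ∀ k : ℕ, homD^[k] (X 0 ^ (T - 1) * X 2 : CX) = X 0 ^ (T - 1) * X 2 := by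
    intro k
    induction k with
    | zero => rfl
    | succ k ih =>
      rw [Function.iterate_succ_apply', ih, homD_X_zero_pow_mul, homD_X_two]
  have h2 : (C η * ∑ i ∈ range T, C ((i.factorial : ℂ)⁻¹) * (X 1 - C ξ * X 0) ^ i *
      X 0 ^ (T - i) : CX) =
      η • ∑ i ∈ range T, C ((i.factorial : ℂ)⁻¹) * (X 1 - C ξ * X 0) ^ i * X 0 ^ (T - i) :=
    (smul_eq_C_mul _ _).symm
  rw [royQ, h2, iterate_homD_sub, iterate_homD_smul, h1, iterate_homD_sum_royQ_terms, map_sub,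
    map_smul, aeval_one_sum_royQ_terms ξ η T (by omega : 1 ≤ T - j), smul_eq_mul, mul_one]
  simp

/-- `Q ∈ ℂ[X]_T` (`T ≥ 1`). [cite: Roy2013, §4, proof of Proposition 4.5] -/
theorem isHomogeneous_royQ (ξ η : ℂ) {T : ℕ} (hT : 1 ≤ T) : (royQ ξ η T).IsHomogeneous T := by
  have hL : (X 1 - C ξ * X 0 : CX).IsHomogeneous 1 :=
    (homogeneousSubmodule (Fin 3) ℂ 1).sub_mem (isHomogeneous_X ℂ 1)
      ((isHomogeneous_X ℂ 0).C_mul ξ)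
  refine (homogeneousSubmodule (Fin 3) ℂ T).sub_mem ?_ ?_
  · have h := (isHomogeneous_X_pow (R := ℂ) (0 : Fin 3) (T - 1)).mul (isHomogeneous_X ℂ 2)
    rwa [show T - 1 + 1 = T by omega] at h
  · refine IsHomogeneous.C_mul (IsHomogeneous.sum _ _ _ fun i hi => ?_) η
    rw [mem_range] at hi
    have h := ((hL.pow i).C_mul ((i.factorial : ℂ)⁻¹)).mul
      (isHomogeneous_X_pow (R := ℂ) (0 : Fin 3) (T - i))
    rwa [one_mul, show i + (T - i) = T by omega] at h

/-- `𝓛(Q) ≤ 1 + c₂ e^{1+c₂}` (Roy: `𝓛(Q) ≤ 1 + |η|exp(1+|ξ|) ≤ c₄`).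
[cite: Roy2013, §4, proof of Proposition 4.5] -/
theorem l1Norm_royQ_le (ξ η : ℂ) (T : ℕ) :
    l1Norm (royQ ξ η T) ≤ 1 + roy_c2 ξ η * Real.exp (1 + roy_c2 ξ η) := by
  have hξ := norm_le_roy_c2_left ξ η
  have hη := norm_le_roy_c2_right ξ η
  have hc := one_le_roy_c2 ξ η
  have hX : ∀ (i : Fin 3) (n : ℕ), l1Norm ((X i : CX) ^ n) ≤ 1 := fun i n =>
    (l1Norm_pow_le _ _).trans (by rw [l1Norm_X, one_pow])
  have hL : l1Norm (X 1 - C ξ * X 0 : CX) ≤ 1 + roy_c2 ξ η := by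
    refine (l1Norm_sub_le _ _).trans ?_
    rw [l1Norm_X]
    exact add_le_add le_rfl ((l1Norm_C_mul_le _ _).trans (by rw [l1Norm_X, mul_one]; exact hξ))
  have hA : l1Norm (X 0 ^ (T - 1) * X 2 : CX) ≤ 1 :=
    (l1Norm_mul_le _ _).trans (by
      calc l1Norm ((X 0 : CX) ^ (T - 1)) * l1Norm (X 2 : CX) ≤ 1 * 1 :=
            mul_le_mul (hX 0 _) (by rw [l1Norm_X]) (l1Norm_nonneg _) zero_le_one
        _ = 1 := mul_one _)
  have hterm : ∀ i ∈ range T, l1Norm (C ((i.factorial : ℂ)⁻¹) * (X 1 - C ξ * X 0) ^ i *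
      X 0 ^ (T - i) : CX) ≤ (1 + roy_c2 ξ η) ^ i / i.factorial := by
    intro i _
    refine (l1Norm_mul_le _ _).trans ?_
    refine (mul_le_mul ((l1Norm_C_mul_le _ _).trans (mul_le_mul_of_nonneg_left
      ((l1Norm_pow_le _ _).trans (pow_le_pow_left₀ (l1Norm_nonneg _) hL i)) (norm_nonneg _)))
      (hX 0 _) (l1Norm_nonneg _) (by positivity)).trans ?_
    rw [mul_one, norm_inv, Complex.norm_natCast, div_eq_inv_mul]
  have hsum : l1Norm (∑ i ∈ range T, C ((i.factorial : ℂ)⁻¹) * (X 1 - C ξ * X 0) ^ i *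
      X 0 ^ (T - i) : CX) ≤ Real.exp (1 + roy_c2 ξ η) :=
    (l1Norm_sum_le _ _).trans ((Finset.sum_le_sum hterm).trans
      (Real.sum_le_exp_of_nonneg (by positivity) T))
  rw [royQ]
  refine (l1Norm_sub_le _ _).trans (add_le_add hA ?_)
  exact (l1Norm_C_mul_le _ _).trans (mul_le_mul hη hsum (l1Norm_nonneg _) (by positivity))

/-- **The value `Q(α) = α₀^T (α₂/α₀ - η ∑_{i<T} δ₁ⁱ/i!)`**, `δ₁ = α₁/α₀ - ξ`, for `α₀ ≠ 0`,
`T ≥ 1`. [cite: Roy2013, §4, proof of Proposition 4.5, (4.3)] -/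
theorem aeval_royQ (ξ η : ℂ) {T : ℕ} (hT : 1 ≤ T) {α : Fin 3 → ℂ} (hα0 : α 0 ≠ 0) :
    aeval α (royQ ξ η T) = α 0 ^ T *
      (α 2 / α 0 - η * ∑ i ∈ range T, ((i.factorial : ℂ)⁻¹ * (α 1 / α 0 - ξ) ^ i)) := by
  have hterm : ∀ i ∈ range T, aeval α (C ((i.factorial : ℂ)⁻¹) * (X 1 - C ξ * X 0) ^ i *
      X 0 ^ (T - i) : CX) = α 0 ^ T * ((i.factorial : ℂ)⁻¹ * (α 1 / α 0 - ξ) ^ i) := by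
    intro i hi
    rw [mem_range] at hi
    simp only [map_mul, aeval_C, Algebra.algebraMap_self, RingHom.id_apply, map_pow, map_sub,
      aeval_X]
    rw [show α 1 / α 0 - ξ = (α 1 - ξ * α 0) / α 0 by field_simp, div_pow,
      show (T : ℕ) = (T - i) + i by omega, pow_add, Nat.add_sub_cancel]
    field_simp
  rw [royQ, map_sub, map_mul, map_mul, map_pow, aeval_X, aeval_X, aeval_C, map_sum,
    Finset.sum_congr rfl hterm, ← Finset.mul_sum]
  simp only [Algebra.algebraMap_self, RingHom.id_apply]
  rw [show (T : ℕ) = (T - 1) + 1 by omega, pow_succ, Nat.add_sub_cancel]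
  field_simp

end Roy2013

end Literature.NumberTheory.Transcendental
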